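import Mathlib
import Literature.Analysis.FluidPDE.CheskidovFriedlander2009.EnergyInequality
import HarnessLib

/-!
# Cheskidov–Friedlander 2009, §2 in the original variables: positivity, `H¹`-regularity and the
# energy equality of `ℓ²` fixed points; the rescaling to `IsSteadyState`; `α^ν₀ → α⁰₀` (Lemma 2.3)

Proof file over `VanishingViscosityLimit.lean` (`rhs`, `force`, `IsFixedPoint`,
`inviscidFixedPoint`, `epsilonD`) and `SteadyState.lean` (`IsSteadyState`, its pinching lemmas
`one_lt`, `pow_four_lt`), for Cheskidov–Friedlander, Physica D 238 (2009) 783–787 =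
arXiv:0810.3718v1, §2 pp. 4–6 and the use made of the fixed point in the proof of Thm. 4.2
(pp. 9–10: "the fixed point `α^ν` (since it is a regular solution) satisfies the energy equality
`ν‖α^ν‖²_{H¹} = (α^ν,f)`"; "`(α^ν,f) → (α⁰,f)` as `ν → 0`"). Everything here is PROVED:

* `IsFixedPoint.pos` — a fixed point with non-negative entries has positive entries
  (`f₀ > 0`; Lemma 2.1 "`A_j > 0` for all `j`", here by the elementary induction on the
  equations rather than the printed tail-sum argument);
* `IsFixedPoint.summable_h1`, `.tsum_h1_le` — `ν‖α‖²_{H¹} ≤ f₀α₀` (truncated balance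
  `sum_mul_rhs` with the non-negative flux), so every non-negative `ℓ²` fixed point is in `H¹`;
* `IsFixedPoint.energy_eq` — the steady ENERGY EQUALITY `ν‖α‖²_{H¹} = f₀α₀` for `0 < c ≤ 3`
  (the flux `(2^c)^Nα_N²α_{N+1}` tends to `0` because `2^{2j}α_j² → 0` and `2^c ≤ 8`);
* `IsFixedPoint.isSteadyState` — the rescaled sequence `A_j = α_j/α⁰_j` (ratio to the inviscid
  fixed point, i.e. `A_j = 2^{cj/3}2^{−c/6}f₀^{−1/2}α_j`, §2) is an `IsSteadyState μ r A` with
  `μ = ν2^{c/6}f₀^{−1/2}`, `r = 2^{2(1−c/3)}`, for `0 < c ≤ 3` (boundedness of `A` from the `H¹`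
  bound: `A_j ≤ ‖α‖_{H¹}2^{(c/3−1)j}/α⁰₀`);
* `IsFixedPoint.abs_apply_zero_sub_le` — **Lemma 2.3 at `j = 0`, quantitatively**: for
  `3/2 < c < 3` and `μ ≤ 1/2`, `|α₀ − α⁰₀| ≤ 4μ·α⁰₀ = 2^{2+c/3}ν`, whence
  `tendsto_epsilon_of_fixedPoints`: along ANY family of non-negative `ℓ²` fixed points `α^ν`,
  `f₀α^ν₀ → ε_d` as `ν → 0⁺` (the last step of the proof of Thm. 4.2).

No new definitions, no new facts.
-/

noncomputable section

open Set Filter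
open scoped BigOperators Topology

namespace Literature.Analysis.FluidPDE.CheskidovFriedlander2009

variable {c ν f₀ : ℝ} {α : ℕ → ℝ}

/-! ### Positivity -/

/-- A fixed point with non-negative entries has positive entries (`f₀ > 0`): `α₀ = 0`
contradicts the forced equation `α₀(ν + α₁) = f₀`, and `α_{j+1} = 0` forces `(2^c)^jα_j² = 0` in
the `(j+1)`-st equation. [cite: CheskidovFriedlander2009, Lemma 2.1 p.4] -/
theorem IsFixedPoint.pos (hα : IsFixedPoint c ν (force f₀) α) (hf : 0 < f₀)
    (hnn : ∀ j, 0 ≤ α j) : ∀ j, 0 < α j := by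
  have hL : (0 : ℝ) < (2 : ℝ) ^ c := Real.rpow_pos_of_pos two_pos c
  intro j
  induction j with
  | zero =>
    rcases (hnn 0).eq_or_lt with h0 | h0
    · have h := hα.2 0
      simp only [rhs, force_zero, ← h0, mul_zero, neg_zero, zero_mul, sub_zero, zero_add] at h
      linarith
    · exact h0
  | succ j ih =>
    rcases (hnn (j + 1)).eq_or_lt with h0 | h0
    · have h := hα.2 (j + 1)
      have hz : α (j + 1) = 0 := h0.symm
      simp only [rhs, force_succ, hz, mul_zero, neg_zero, zero_mul, sub_zero, add_zero,
        zero_add] at h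
      -- `h : (2^c)^j * α j ^ 2 = 0`
      rcases mul_eq_zero.mp h with h1 | h1
      · exact absurd h1 (pow_ne_zero _ hL.ne')
      · exact absurd (pow_eq_zero_iff two_ne_zero |>.mp h1) ih.ne'
    · exact h0

/-! ### The `H¹` bound and the energy equality -/

/-- The truncated steady balance: `νΣ_{j≤N}2^{2j}α_j² + (2^c)^Nα_N²α_{N+1} = f₀α₀` for every fixed
point. [cite: CheskidovFriedlander2009, Lemma 2.1 p.4 (first display of the proof)] -/
theorem IsFixedPoint.sum_h1_eq (hα : IsFixedPoint c ν (force f₀) α) (N : ℕ) :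
    ν * ∑ j ∈ Finset.range (N + 1), (2 : ℝ) ^ (2 * j) * α j ^ 2
      + ((2 : ℝ) ^ c) ^ N * α N ^ 2 * α (N + 1) = f₀ * α 0 := by
  have h := sum_mul_rhs c ν (force f₀) α N
  have h0 : ∑ j ∈ Finset.range (N + 1), α j * rhs c ν (force f₀) α j = 0 :=
    Finset.sum_eq_zero fun j _ => by rw [hα.2 j, mul_zero]
  rw [h0, sum_force_mul] at h
  linarith

/-- Partial `H¹` sums of a non-negative fixed point are bounded: `νΣ_{j≤N}2^{2j}α_j² ≤ f₀α₀`.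
[cite: CheskidovFriedlander2009, Lemma 2.1 p.4] -/
theorem IsFixedPoint.sum_h1_le (hα : IsFixedPoint c ν (force f₀) α) (hnn : ∀ j, 0 ≤ α j)
    (N : ℕ) : ν * ∑ j ∈ Finset.range (N + 1), (2 : ℝ) ^ (2 * j) * α j ^ 2 ≤ f₀ * α 0 := by
  have h := hα.sum_h1_eq N
  have hL : (0 : ℝ) < (2 : ℝ) ^ c := Real.rpow_pos_of_pos two_pos c
  have hF : 0 ≤ ((2 : ℝ) ^ c) ^ N * α N ^ 2 * α (N + 1) :=
    mul_nonneg (mul_nonneg (pow_nonneg hL.le N) (sq_nonneg _)) (hnn (N + 1))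
  linarith

/-- **Every non-negative `ℓ²` fixed point is in `H¹`** (`ν > 0`): `Σ_j 2^{2j}α_j² < ∞`.
[cite: CheskidovFriedlander2009, Lemma 2.1 p.4] -/
theorem IsFixedPoint.summable_h1 (hα : IsFixedPoint c ν (force f₀) α) (hν : 0 < ν)
    (hnn : ∀ j, 0 ≤ α j) : Summable fun j => (2 : ℝ) ^ (2 * j) * α j ^ 2 := by
  have hterm : ∀ j, 0 ≤ (2 : ℝ) ^ (2 * j) * α j ^ 2 := fun j =>
    mul_nonneg (pow_nonneg zero_le_two _) (sq_nonneg _)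
  have hB : ∀ n, ν * ∑ j ∈ Finset.range n, (2 : ℝ) ^ (2 * j) * α j ^ 2 ≤ f₀ * α 0 := by
    intro n
    cases n with
    | zero =>
      have h1 := hα.sum_h1_le hnn 0
      have h2 : 0 ≤ ν * ∑ j ∈ Finset.range (0 + 1), (2 : ℝ) ^ (2 * j) * α j ^ 2 :=
        mul_nonneg hν.le (Finset.sum_nonneg fun j _ => hterm j)
      simp only [Finset.range_zero, Finset.sum_empty, mul_zero]
      linarith
    | succ N => exact hα.sum_h1_le hnn N
  refine summable_of_sum_range_le (c := f₀ * α 0 / ν) hterm fun n => ?_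
  rw [le_div_iff₀ hν, mul_comm]
  exact hB n

/-- `ν‖α‖²_{H¹} ≤ f₀α₀` for a non-negative `ℓ²` fixed point (`ν > 0`).
[cite: CheskidovFriedlander2009, Lemma 2.1 p.4] -/
theorem IsFixedPoint.tsum_h1_le (hα : IsFixedPoint c ν (force f₀) α) (hν : 0 < ν)
    (hnn : ∀ j, 0 ≤ α j) : ν * ∑' j, (2 : ℝ) ^ (2 * j) * α j ^ 2 ≤ f₀ * α 0 := by
  have hs := hα.summable_h1 hν hnn
  have hlim : Tendsto (fun N => ν * ∑ j ∈ Finset.range (N + 1), (2 : ℝ) ^ (2 * j) * α j ^ 2)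
      atTop (𝓝 (ν * ∑' j, (2 : ℝ) ^ (2 * j) * α j ^ 2)) :=
    ((hs.hasSum.tendsto_sum_nat).comp (tendsto_add_atTop_nat 1)).const_mul ν
  exact le_of_tendsto' hlim fun N => hα.sum_h1_le hnn N

/-- Coordinates of an `H¹` sequence: `α_j² ≤ ‖α‖²_{H¹}/2^{2j}`. [cite: CheskidovFriedlander2009, Lemma 2.1 p.4] -/
theorem sq_le_tsum_h1_div {α : ℕ → ℝ} (hs : Summable fun j => (2 : ℝ) ^ (2 * j) * α j ^ 2)
    (j : ℕ) : α j ^ 2 ≤ (∑' i, (2 : ℝ) ^ (2 * i) * α i ^ 2) / (2 : ℝ) ^ (2 * j) := by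
  rw [le_div_iff₀ (pow_pos two_pos _), mul_comm]
  exact hs.le_tsum j fun i _ => mul_nonneg (pow_nonneg zero_le_two _) (sq_nonneg _)

/-- **The steady energy equality** `ν‖α‖²_{H¹} = f₀α₀` for a non-negative `ℓ²` fixed point, when
`0 < c ≤ 3` and `ν > 0`: the flux `(2^c)^Nα_N²α_{N+1} ≤ (2^c/8)^N·(2^{2N}α_N²)·‖α‖_{H¹}/2`
tends to `0`. (CF: "the fixed point `α^ν` (since it is a regular solution) satisfies the energy
equality `ν‖α^ν‖²_{H¹} = (α^ν,f)`".) [cite: CheskidovFriedlander2009, Thm 4.2 p.9 (proof) and Lemma 2.1 p.4] -/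
theorem IsFixedPoint.energy_eq (hα : IsFixedPoint c ν (force f₀) α) (hc3 : c ≤ 3)
    (hν : 0 < ν) (hnn : ∀ j, 0 ≤ α j) :
    ν * ∑' j, (2 : ℝ) ^ (2 * j) * α j ^ 2 = f₀ * α 0 := by
  have hs := hα.summable_h1 hν hnn
  set S : ℝ := ∑' j, (2 : ℝ) ^ (2 * j) * α j ^ 2 with hS
  have hS0 : 0 ≤ S := tsum_nonneg fun j => mul_nonneg (pow_nonneg zero_le_two _) (sq_nonneg _)
  -- the flux `F_N = f₀α₀ − ν S_N`
  set F : ℕ → ℝ := fun N => ((2 : ℝ) ^ c) ^ N * α N ^ 2 * α (N + 1) with hF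
  have hFeq : ∀ N, F N = f₀ * α 0 - ν * ∑ j ∈ Finset.range (N + 1), (2 : ℝ) ^ (2 * j) * α j ^ 2 :=
    fun N => by have := hα.sum_h1_eq N; simp only [hF]; linarith
  -- `F_N → f₀α₀ − νS`
  have hFlim : Tendsto F atTop (𝓝 (f₀ * α 0 - ν * S)) := by
    have h1 : Tendsto (fun N => ν * ∑ j ∈ Finset.range (N + 1), (2 : ℝ) ^ (2 * j) * α j ^ 2)
        atTop (𝓝 (ν * S)) :=
      ((hs.hasSum.tendsto_sum_nat).comp (tendsto_add_atTop_nat 1)).const_mul ν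
    have := (tendsto_const_nhds (x := f₀ * α 0)).sub h1
    exact this.congr fun N => (hFeq N).symm
  -- `F_N → 0`: `0 ≤ F_N ≤ (2^{2N}α_N²) · √S / 2`
  have hL : (0 : ℝ) < (2 : ℝ) ^ c := Real.rpow_pos_of_pos two_pos c
  have hL8 : (2 : ℝ) ^ c ≤ 8 := by
    have : (2 : ℝ) ^ c ≤ (2 : ℝ) ^ (3 : ℝ) :=
      Real.rpow_le_rpow_of_exponent_le (by norm_num) hc3
    simpa using this.trans_eq (by norm_num : (2 : ℝ) ^ (3 : ℝ) = 8)
  have hsN : Tendsto (fun N => (2 : ℝ) ^ (2 * N) * α N ^ 2) atTop (𝓝 0) := hs.tendsto_atTop_zero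
  have hbound : ∀ N, F N ≤ (2 : ℝ) ^ (2 * N) * α N ^ 2 * (Real.sqrt S / 2) := by
    intro N
    -- `α_{N+1} ≤ √S / 2^{N+1}`
    have h1 : α (N + 1) ≤ Real.sqrt S / (2 : ℝ) ^ (N + 1) := by
      rw [le_div_iff₀ (pow_pos two_pos _)]
      have hsq : (α (N + 1) * (2 : ℝ) ^ (N + 1)) ^ 2 ≤ S := by
        have := sq_le_tsum_h1_div hs (N + 1)
        rw [le_div_iff₀ (pow_pos two_pos _)] at this
        calc (α (N + 1) * (2 : ℝ) ^ (N + 1)) ^ 2 = α (N + 1) ^ 2 * (2 : ℝ) ^ (2 * (N + 1)) := by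
              ring
          _ ≤ S := this
      calc α (N + 1) * (2 : ℝ) ^ (N + 1) ≤ |α (N + 1) * (2 : ℝ) ^ (N + 1)| := le_abs_self _
        _ = Real.sqrt ((α (N + 1) * (2 : ℝ) ^ (N + 1)) ^ 2) := (Real.sqrt_sq_eq_abs _).symm
        _ ≤ Real.sqrt S := Real.sqrt_le_sqrt hsq
    -- `(2^c)^N ≤ 8^N = 2^{2N} · 2^{N+1} / 2`
    have h2 : ((2 : ℝ) ^ c) ^ N ≤ (8 : ℝ) ^ N := pow_le_pow_left₀ hL.le hL8 N
    have h3 : (8 : ℝ) ^ N = (2 : ℝ) ^ (2 * N) * (2 : ℝ) ^ (N + 1) / 2 := by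
      rw [show (8 : ℝ) = 2 ^ 3 by norm_num, ← pow_mul]
      field_simp
      ring
    have hαN : 0 ≤ α N ^ 2 := sq_nonneg _
    have hαN1 : 0 ≤ α (N + 1) := hnn (N + 1)
    calc F N = ((2 : ℝ) ^ c) ^ N * α N ^ 2 * α (N + 1) := rfl
      _ ≤ (8 : ℝ) ^ N * α N ^ 2 * (Real.sqrt S / (2 : ℝ) ^ (N + 1)) := by
          gcongr
      _ = (2 : ℝ) ^ (2 * N) * α N ^ 2 * (Real.sqrt S / 2) := by
          rw [h3]
          field_simp
  have hFnn : ∀ N, 0 ≤ F N := fun N =>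
    mul_nonneg (mul_nonneg (pow_nonneg hL.le N) (sq_nonneg _)) (hnn (N + 1))
  have hF0 : Tendsto F atTop (𝓝 0) := by
    refine squeeze_zero hFnn hbound ?_
    simpa using hsN.mul_const (Real.sqrt S / 2)
  have := tendsto_nhds_unique hFlim hF0
  linarith

/-! ### The rescaling to `IsSteadyState` (§2, (2.1)) -/

/-- The ratio `r = λ^β = 2^{2(1−c/3)}` of §2 equals `4·(2^{−c/3})²`. [cite: CheskidovFriedlander2009, §2 (2.1) p.4] -/
theorem two_rpow_beta_eq (c : ℝ) : (2 : ℝ) ^ (2 - 2 * c / 3) = 4 * ((2 : ℝ) ^ (-(c / 3))) ^ 2 := by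
  rw [← Real.rpow_natCast ((2 : ℝ) ^ (-(c / 3))) 2, ← Real.rpow_mul (by norm_num : (0 : ℝ) ≤ 2),
    show (4 : ℝ) = (2 : ℝ) ^ (2 : ℝ) by norm_num, ← Real.rpow_add (by norm_num : (0 : ℝ) < 2)]
  congr 1
  push_cast
  ring

/-- `μ = ν2^{c/6}f₀^{−1/2}` of §2 satisfies `μ · (α⁰₀ · 2^{−c/3}) = ν` (`α⁰₀ = 2^{c/6}√f₀`).
[cite: CheskidovFriedlander2009, §2 (2.1) p.4] -/
theorem mu_mul_eq {c f₀ : ℝ} (hf : 0 < f₀) (ν : ℝ) :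
    ν * (2 : ℝ) ^ (c / 6) / Real.sqrt f₀ * ((2 : ℝ) ^ (c / 6) * Real.sqrt f₀ * (2 : ℝ) ^ (-(c / 3)))
      = ν := by
  have hs : 0 < Real.sqrt f₀ := Real.sqrt_pos.mpr hf
  have h := two_rpow_sixth_sq_mul_ratio c
  field_simp
  linear_combination ν * h

/-- The algebra of the rescaling (2.1): in the variables `A_j = α_j/(κq^j)` the fixed-point
equations become `A₀A₁ + μA₀ = 1`, `A_j² − A_{j+1}A_{j+2} = μ(4q²)^{j+1}A_{j+1}`, given the
relations `pq³ = 1`, `κ²q = f₀`, `μκq = ν` between the constants (`p = 2^c`, `q = 2^{−c/3}`,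
`κ = α⁰₀`). [cite: CheskidovFriedlander2009, §2 (2.1) p.4] -/
theorem steady_equations_of_relations {p q κ μ ν f₀ : ℝ} {α A : ℕ → ℝ} (hq0 : q ≠ 0)
    (hκ0 : κ ≠ 0) (hp0 : p ≠ 0) (hpq : p * q ^ 3 = 1) (hκq : κ ^ 2 * q = f₀)
    (hμ : μ * (κ * q) = ν) (hrep : ∀ k, α k = κ * q ^ k * A k)
    (E0 : -(ν * α 0) - α 0 * α 1 + f₀ = 0)
    (E : ∀ j : ℕ, -(ν * (4 : ℝ) ^ (j + 1) * α (j + 1)) + p ^ j * α j ^ 2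
      - p ^ (j + 1) * α (j + 1) * α (j + 2) = 0) :
    A 0 * A 1 + μ * A 0 = 1 ∧
      ∀ j : ℕ, A j ^ 2 - A (j + 1) * A (j + 2) = μ * (4 * q ^ 2) ^ (j + 1) * A (j + 1) := by
  constructor
  · rw [hrep 0, hrep 1, pow_zero, pow_one, mul_one] at E0
    have hκq0 : κ ^ 2 * q ≠ 0 := mul_ne_zero (pow_ne_zero 2 hκ0) hq0
    have key : κ ^ 2 * q * (A 0 * A 1 + μ * A 0 - 1) = 0 := by
      linear_combination (-1 : ℝ) * E0 + (κ * A 0) * hμ - hκq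
    have := (mul_eq_zero.mp key).resolve_left hκq0
    linarith
  · intro j
    have Ej := E j
    rw [hrep j, hrep (j + 1), hrep (j + 2)] at Ej
    have hpqj : p ^ j * q ^ (3 * j) = 1 := by
      rw [pow_mul, ← mul_pow, hpq, one_pow]
    have hne : κ ^ 2 * q ^ (2 * j) * p ^ j ≠ 0 :=
      mul_ne_zero (mul_ne_zero (pow_ne_zero 2 hκ0) (pow_ne_zero _ hq0)) (pow_ne_zero _ hp0)
    have key : κ ^ 2 * q ^ (2 * j) * p ^ j *
        (A j ^ 2 - A (j + 1) * A (j + 2) - μ * (4 * q ^ 2) ^ (j + 1) * A (j + 1)) = 0 := by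
      linear_combination Ej + (κ ^ 2 * q ^ (2 * j) * p ^ j * A (j + 1) * A (j + 2)) * hpq
        + (-(4 : ℝ) ^ (j + 1) * κ * q ^ (j + 1) * A (j + 1)) * hμ
        + (-(4 : ℝ) ^ (j + 1) * κ * q ^ (j + 2) * A (j + 1) * μ * κ) * hpqj
    have := (mul_eq_zero.mp key).resolve_left hne
    linarith

/-- **The rescaled steady state.** For a non-negative `ℓ²` fixed point `α` the ratios `A_j = α_j/α⁰_j` to the inviscid fixed point — i.e. §2's
`A_j = 2^{cj/3}2^{−c/6}f₀^{−1/2}α_j` — form an `IsSteadyState μ r A` of `SteadyState.lean` with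
`μ = ν2^{c/6}f₀^{−1/2}` and `r = 2^{2(1−c/3)}` (`c ≤ 3`, `ν > 0`, `f₀ > 0`): positivity
(`IsFixedPoint.pos`), the equations (2.1), and boundedness (`A_j ≤ ‖α‖_{H¹}/α⁰₀` from the `H¹` bound and `2^{−cj/3} ≥ 2^{−j}`).
[cite: CheskidovFriedlander2009, §2 (2.1) p.4 and Lemma 2.1] -/
theorem IsFixedPoint.isSteadyState (hα : IsFixedPoint c ν (force f₀) α) (hc3 : c ≤ 3)
    (hν : 0 < ν) (hf : 0 < f₀) (hnn : ∀ j, 0 ≤ α j) :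
    IsSteadyState (ν * (2 : ℝ) ^ (c / 6) / Real.sqrt f₀) ((2 : ℝ) ^ (2 - 2 * c / 3))
      (fun j => α j / inviscidFixedPoint c f₀ j) := by
  -- notation: `p = 2^c`, `q = 2^{−c/3}`, `κ = α⁰₀ = 2^{c/6}√f₀`, `μ`, `A`
  set p : ℝ := (2 : ℝ) ^ c with hp
  set q : ℝ := (2 : ℝ) ^ (-(c / 3)) with hq
  set κ : ℝ := (2 : ℝ) ^ (c / 6) * Real.sqrt f₀ with hκ
  set μ : ℝ := ν * (2 : ℝ) ^ (c / 6) / Real.sqrt f₀ with hμdef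
  have hq0 : 0 < q := Real.rpow_pos_of_pos two_pos _
  have hκ0 : 0 < κ := mul_pos (Real.rpow_pos_of_pos two_pos _) (Real.sqrt_pos.mpr hf)
  have hpq : p * q ^ 3 = 1 := two_rpow_mul_ratio_pow_three c
  have hκq : κ ^ 2 * q = f₀ := by
    rw [hκ, mul_pow, Real.sq_sqrt hf.le, mul_right_comm, two_rpow_sixth_sq_mul_ratio, one_mul]
  have hμ : μ * (κ * q) = ν := mu_mul_eq hf ν
  have hr : (2 : ℝ) ^ (2 - 2 * c / 3) = 4 * q ^ 2 := two_rpow_beta_eq c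
  have hinv : ∀ j, inviscidFixedPoint c f₀ j = κ * q ^ j := fun j => rfl
  set A : ℕ → ℝ := fun j => α j / inviscidFixedPoint c f₀ j with hA
  have hrep : ∀ k, α k = κ * q ^ k * A k := fun k => by
    rw [hA]
    dsimp only
    rw [hinv, mul_div_cancel₀ _ (mul_pos hκ0 (pow_pos hq0 k)).ne']
  have hpos := hα.pos hf hnn
  -- the equations, from the algebraic lemma
  have E0 : -(ν * α 0) - α 0 * α 1 + f₀ = 0 := by
    have := hα.2 0
    simpa only [rhs, force_zero] using this
  have E : ∀ j : ℕ, -(ν * (4 : ℝ) ^ (j + 1) * α (j + 1)) + p ^ j * α j ^ 2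
      - p ^ (j + 1) * α (j + 1) * α (j + 2) = 0 := by
    intro j
    have h := hα.2 (j + 1)
    have h4 : (2 : ℝ) ^ (2 * (j + 1)) = 4 ^ (j + 1) := by rw [pow_mul]; norm_num
    simpa only [rhs, force_succ, add_zero, h4] using h
  have heqs := steady_equations_of_relations hq0.ne' hκ0.ne' (Real.rpow_pos_of_pos two_pos c).ne'
    hpq hκq hμ hrep E0 E
  refine ⟨fun j => div_pos (hpos j) (inviscidFixedPoint_pos c hf j), heqs.1, fun j => ?_, ?_⟩
  · rw [hr]
    exact heqs.2 j
  · -- boundedness from the `H¹` bound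
    have hs := hα.summable_h1 hν hnn
    set S : ℝ := ∑' i, (2 : ℝ) ^ (2 * i) * α i ^ 2 with hS
    refine ⟨Real.sqrt S / κ, fun j => ?_⟩
    have h1 : α j ≤ Real.sqrt S / (2 : ℝ) ^ j := by
      rw [le_div_iff₀ (pow_pos two_pos _)]
      have hsq : (α j * (2 : ℝ) ^ j) ^ 2 ≤ S := by
        have := sq_le_tsum_h1_div hs j
        rw [le_div_iff₀ (pow_pos two_pos _)] at this
        calc (α j * (2 : ℝ) ^ j) ^ 2 = α j ^ 2 * (2 : ℝ) ^ (2 * j) := by ring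
          _ ≤ S := this
      calc α j * (2 : ℝ) ^ j ≤ |α j * (2 : ℝ) ^ j| := le_abs_self _
        _ = Real.sqrt ((α j * (2 : ℝ) ^ j) ^ 2) := (Real.sqrt_sq_eq_abs _).symm
        _ ≤ Real.sqrt S := Real.sqrt_le_sqrt hsq
    -- `q^j ≥ 2^{−j}` since `c ≤ 3`
    have hq2 : ((2 : ℝ) ^ j)⁻¹ ≤ q ^ j := by
      rw [← inv_pow]
      refine pow_le_pow_left₀ (by positivity) ?_ j
      rw [hq, show ((2 : ℝ))⁻¹ = (2 : ℝ) ^ (-(1 : ℝ)) by norm_num]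
      exact Real.rpow_le_rpow_of_exponent_le (by norm_num) (by linarith)
    show α j / inviscidFixedPoint c f₀ j ≤ Real.sqrt S / κ
    rw [hinv, div_le_div_iff₀ (mul_pos hκ0 (pow_pos hq0 j)) hκ0]
    have hS0 : 0 ≤ Real.sqrt S := Real.sqrt_nonneg _
    calc α j * κ ≤ Real.sqrt S / (2 : ℝ) ^ j * κ := by gcongr
      _ = Real.sqrt S * (κ * ((2 : ℝ) ^ j)⁻¹) := by ring
      _ ≤ Real.sqrt S * (κ * q ^ j) := by gcongr

/-! ### Lemma 2.3 at the forced shell: `α^ν₀ → α⁰₀`, and `(α^ν,f) → ε_d` -/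

/-- **Lemma 2.3 at `j = 0`, with a rate**: for `3/2 < c < 3`, `ν > 0`, `f₀ > 0` and
`μ = ν2^{c/6}f₀^{−1/2} ≤ 1/4`, every non-negative `ℓ²` fixed point satisfies
`|α₀ − α⁰₀| ≤ 4μ·α⁰₀ = 4·2^{c/3}ν` (from the pinching `1 − μA₀ < A₀²`, `A₀⁴ < 1 + μrA₀` of
`SteadyState.lean`, `r < 2`). [cite: CheskidovFriedlander2009, Lemma 2.3 p.5] -/
theorem IsFixedPoint.abs_apply_zero_sub_le (hα : IsFixedPoint c ν (force f₀) α) (hc : 3 / 2 < c)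
    (hc3 : c < 3) (hν : 0 < ν) (hf : 0 < f₀) (hnn : ∀ j, 0 ≤ α j)
    (hμ : ν * (2 : ℝ) ^ (c / 6) / Real.sqrt f₀ ≤ 1 / 4) :
    |α 0 - inviscidFixedPoint c f₀ 0| ≤ 4 * (2 : ℝ) ^ (c / 3) * ν := by
  have hst := hα.isSteadyState hc3.le hν hf hnn
  set μ : ℝ := ν * (2 : ℝ) ^ (c / 6) / Real.sqrt f₀ with hμdef
  set r : ℝ := (2 : ℝ) ^ (2 - 2 * c / 3) with hrdef
  set κ : ℝ := inviscidFixedPoint c f₀ 0 with hκdef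
  have hκ0 : 0 < κ := inviscidFixedPoint_pos c hf 0
  have hμ0 : 0 < μ := by
    have : 0 < (2 : ℝ) ^ (c / 6) := Real.rpow_pos_of_pos two_pos _
    have : 0 < Real.sqrt f₀ := Real.sqrt_pos.mpr hf
    positivity
  have hr1 : 1 < r := by
    rw [hrdef]
    exact Real.one_lt_rpow (by norm_num) (by linarith)
  have hr2 : r < 2 := by
    rw [hrdef]
    calc (2 : ℝ) ^ (2 - 2 * c / 3) < (2 : ℝ) ^ (1 : ℝ) :=
          Real.rpow_lt_rpow_of_exponent_lt (by norm_num) (by linarith)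
      _ = 2 := Real.rpow_one 2
  set A0 : ℝ := α 0 / κ with hA0
  have hA0pos : 0 < A0 := hst.pos 0
  have h1 : 1 < A0 ^ 2 + μ * A0 := hst.one_lt hμ0 hr1 hr2
  have h2 : A0 ^ 4 < 1 + μ * r * A0 := hst.pow_four_lt hμ0 hr1 hr2
  -- `|A₀ − 1| ≤ 4μ`
  have hA : |A0 - 1| ≤ 4 * μ := by
    rw [abs_le]
    constructor
    · -- lower: if `A₀ < 1` then `A₀ > A₀² > 1 − μA₀ ≥ 1 − μ·1`
      by_cases hlt : A0 < 1
      · nlinarith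
      · linarith
    · -- upper: if `A₀ ≥ 1` then `A₀ ≤ A₀⁴ < 1 + 2μA₀`, so `A₀(1 − 2μ) < 1`
      by_cases hge : 1 ≤ A0
      · have h3 : A0 ≤ A0 ^ 4 := by
          have := one_le_pow₀ (M₀ := ℝ) (n := 3) hge
          nlinarith
        have h4 : A0 * (1 - 2 * μ) < 1 := by nlinarith
        nlinarith
      · linarith
  -- back to `α₀ = κA₀`, `4μκ = 4·2^{c/3}ν`
  have hακ : α 0 - κ = κ * (A0 - 1) := by
    rw [hA0]
    field_simp
  have hμκ : μ * κ = (2 : ℝ) ^ (c / 3) * ν := by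
    have h := mu_mul_eq (c := c) hf ν
    have hq : (2 : ℝ) ^ (c / 3) * (2 : ℝ) ^ (-(c / 3)) = 1 := by
      rw [← Real.rpow_add (by norm_num : (0 : ℝ) < 2)]
      norm_num
    have hq0 : (2 : ℝ) ^ (-(c / 3)) ≠ 0 := (Real.rpow_pos_of_pos two_pos _).ne'
    -- `μκq = ν` and `2^{c/3} q = 1`
    have : μ * κ * (2 : ℝ) ^ (-(c / 3)) = (2 : ℝ) ^ (c / 3) * ν * (2 : ℝ) ^ (-(c / 3)) := by
      rw [hκdef]
      simp only [inviscidFixedPoint, pow_zero, mul_one]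
      linear_combination h - ν * hq
    exact mul_right_cancel₀ hq0 this
  rw [hακ, abs_mul, abs_of_pos hκ0]
  calc κ * |A0 - 1| ≤ κ * (4 * μ) := mul_le_mul_of_nonneg_left hA hκ0.le
    _ = 4 * (μ * κ) := by ring
    _ = 4 * (2 : ℝ) ^ (c / 3) * ν := by rw [hμκ]; ring

/-- **The last step of the proof of Thm. 4.2**: along any family `ν ↦ α^ν` of non-negative `ℓ²`
fixed points (`3/2 < c < 3`, `f₀ > 0`), `(α^ν,f) = f₀α^ν₀ → f₀α⁰₀ = ε_d` as `ν → 0⁺`.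
[cite: CheskidovFriedlander2009, Thm 4.2 p.10 (proof: "Since `(α^ν,f) → (α⁰,f)` as `ν → 0`")] -/
theorem tendsto_epsilon_of_fixedPoints {c f₀ : ℝ} (hc : 3 / 2 < c) (hc3 : c < 3) (hf : 0 < f₀)
    {α : ℝ → ℕ → ℝ} (hα : ∀ ν, 0 < ν → IsFixedPoint c ν (force f₀) (α ν) ∧ ∀ j, 0 ≤ α ν j) :
    Tendsto (fun ν => f₀ * α ν 0) (𝓝[>] 0) (𝓝 (epsilonD c f₀)) := by
  -- `|f₀α^ν₀ − ε_d| ≤ f₀·4·2^{c/3}·ν` for `0 < ν ≤ ν₁`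
  set ν₁ : ℝ := Real.sqrt f₀ / (4 * (2 : ℝ) ^ (c / 6)) with hν₁
  have h26 : 0 < (2 : ℝ) ^ (c / 6) := Real.rpow_pos_of_pos two_pos _
  have hs : 0 < Real.sqrt f₀ := Real.sqrt_pos.mpr hf
  have hν₁0 : 0 < ν₁ := by positivity
  have hbound : ∀ ν, 0 < ν → ν ≤ ν₁ →
      |f₀ * α ν 0 - epsilonD c f₀| ≤ f₀ * (4 * (2 : ℝ) ^ (c / 3)) * ν := by
    intro ν hν hνle
    have hμ : ν * (2 : ℝ) ^ (c / 6) / Real.sqrt f₀ ≤ 1 / 4 := by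
      rw [div_le_iff₀ hs]
      rw [hν₁, le_div_iff₀ (by positivity)] at hνle
      linarith
    have h := (hα ν hν).1.abs_apply_zero_sub_le hc hc3 hν hf (hα ν hν).2 hμ
    rw [epsilonD, ← mul_sub, abs_mul, abs_of_pos hf]
    calc f₀ * |α ν 0 - inviscidFixedPoint c f₀ 0| ≤ f₀ * (4 * (2 : ℝ) ^ (c / 3) * ν) :=
          mul_le_mul_of_nonneg_left h hf.le
      _ = f₀ * (4 * (2 : ℝ) ^ (c / 3)) * ν := by ring
  -- squeeze
  have hlin : Tendsto (fun ν : ℝ => f₀ * (4 * (2 : ℝ) ^ (c / 3)) * ν) (𝓝[>] 0) (𝓝 0) := by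
    have : Tendsto (fun ν : ℝ => f₀ * (4 * (2 : ℝ) ^ (c / 3)) * ν) (𝓝 0) (𝓝 0) := by
      simpa using (tendsto_id.const_mul (f₀ * (4 * (2 : ℝ) ^ (c / 3)))).mono_left
        (le_refl (𝓝 (0 : ℝ)))
    exact this.mono_left nhdsWithin_le_nhds
  rw [tendsto_iff_norm_sub_tendsto_zero]
  refine squeeze_zero_norm' ?_ hlin
  have hev : ∀ᶠ ν in 𝓝[>] (0 : ℝ), 0 < ν ∧ ν ≤ ν₁ := by
    have h1 : ∀ᶠ ν in 𝓝[>] (0 : ℝ), 0 < ν := self_mem_nhdsWithin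
    have h2 : ∀ᶠ ν in 𝓝[>] (0 : ℝ), ν ≤ ν₁ :=
      mem_nhdsWithin_of_mem_nhds (Iic_mem_nhds hν₁0)
    exact h1.and h2
  filter_upwards [hev] with ν hν
  simpa [Real.norm_eq_abs, abs_abs] using hbound ν hν.1 hν.2


end Literature.Analysis.FluidPDE.CheskidovFriedlander2009

end
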